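import Summits.FinalStateConjecture.FinalStateConjecture.Theorems.EIHFluxBalanceInertialRecessionStubPseudotensorBoundCalculus

/-!
# Stub `stub_pseudotensorBound` (line `sublinear-is-free-clean-window-charges`), part 3:
# the Landau–Lifshitz complex `Σ_α ∂_α h^{μνα}` in the `2`-jet of the components

Helper file for `stmt-FinalStateConjecture-10166` (crux `InertialRecession`). For components `g` that
are `C²` at `x` with `det (g_{μν}(x)) ≠ 0` we expand `emComplex g x μ ν = (16π)⁻¹ Σ_{αβ} ∂_α∂_β H^{μβνα}`
(LL (96.2)–(96.5)), `H^{μβνα} = −g (g^{μν}g^{βα} − g^{βν}g^{μα})`, by the Leibniz rule with Jacobi's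
formula and the derivative of the inverse (part 2), into an explicit polynomial in `det`, `g^{ij}`,
`∂g`, `∂∂g` at `x`, written as (LINEAR in `∂∂g`) + (QUADRATIC in `∂g`) (`emComplex_eq_twoJet`, LL (96.8)).
-/

noncomputable section

set_option linter.dupNamespace false
set_option linter.unusedSimpArgs false
set_option maxSynthPendingDepth 3
set_option maxRecDepth 16384

open Filter Set
open scoped Topology Matrix

namespace Summit.FinalStateConjecture.FinalStateConjecture.Theorems.SublinearIsFree.PseudotensorBound

open Literature.Geometry.Lorentzian Literature.Geometry.Lorentzian.LandauLifshitz
  Literature.Analysis.Calculus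

variable {g : E4 → E4 →L[ℝ] E4 →L[ℝ] ℝ} {x y : E4}

/-- The coordinate vectors `∂_μ` (local shorthand). -/
local notation "𝐞" => E4.basisVector

/-- **`∂_β H^{μβνα}` at a point of differentiability with `det ≠ 0`**:
`∂_β[−g (g^{μν}g^{βα} − g^{βν}g^{μα})] = −(g Σ g^{ρσ}∂_β g_{σρ})(…) + g (…)` (Leibniz + Jacobi +
derivative of the inverse). [cite: LandauLifshitz1975, §96 (96.2)] -/
theorem fderiv_superpotential (hgy : DifferentiableAt ℝ g y) (hdet : metricDet g y ≠ 0)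
    (μ ν α β : Fin 4) :
    fderiv ℝ (fun z ↦ superpotential g z μ β ν α) y (𝐞 β) =
      (-(metricDet g y * (∑ t1, ∑ t2, upper g y t1 t2 * fderiv ℝ g y (𝐞 β) (𝐞 t2) (𝐞 t1)))) * (upper
        g y μ ν * upper g y β α - upper g y β ν * upper g y μ α) + metricDet g y * ((∑ v1, ∑ v2,
        upper g y μ v1 * upper g y v2 ν * fderiv ℝ g y (𝐞 β) (𝐞 v1) (𝐞 v2)) * upper g y β α + upper
        g y μ ν * (∑ v1, ∑ v2, upper g y β v1 * upper g y v2 α * fderiv ℝ g y (𝐞 β) (𝐞 v1) (𝐞 v2)) -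
        (∑ v1, ∑ v2, upper g y β v1 * upper g y v2 ν * fderiv ℝ g y (𝐞 β) (𝐞 v1) (𝐞 v2)) * upper g y
        μ α - upper g y β ν * (∑ v1, ∑ v2, upper g y μ v1 * upper g y v2 α * fderiv ℝ g y (𝐞 β) (𝐞
        v1) (𝐞 v2))) := by
  have hD : HasFDerivAt (fun z ↦ metricDet g z) (fderiv ℝ (metricDet g) y) y :=
    (differentiableAt_metricDet hgy).hasFDerivAt
  have hu : ∀ i j, HasFDerivAt (fun z ↦ upper g z i j) (fderiv ℝ (fun z ↦ upper g z i j) y) y :=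
    fun i j ↦ (differentiableAt_upper hgy hdet i j).hasFDerivAt
  have hS : HasFDerivAt (fun z ↦
      (-metricDet g z) * (upper g z μ ν * upper g z β α - upper g z β ν * upper g z μ α)) _ y :=
    ((((hD).fun_neg)).fun_mul (((((hu μ ν)).fun_mul (hu β α))).fun_sub (((hu β ν)).fun_mul (hu μ α))))
  rw [show (fun z ↦ superpotential g z μ β ν α) = (fun z ↦
      (-metricDet g z) * (upper g z μ ν * upper g z β α - upper g z β ν * upper g z μ α)) from rfl, hS.fderiv]
  simp only [_root_.add_apply, _root_.sub_apply, _root_.neg_apply, _root_.smul_apply, smul_eq_mul,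
    fderiv_metricDet hgy hdet, fderiv_upper hgy hdet]
  ring

/-- **`h^{μνα}` near `x` in the `1`-jet**: on a neighbourhood of `x` (where `g` is differentiable
and `det ≠ 0`), `hField g y μ ν α = (16π)⁻¹ Σ_β ∂_β H^{μβνα}(y)` with `∂_β H` expanded by
`fderiv_superpotential`. [cite: LandauLifshitz1975, §96 (96.2)] -/
theorem hField_eventuallyEq (hg : ContDiffAt ℝ 2 g x) (hdet : metricDet g x ≠ 0) (μ ν α : Fin 4) :
    (fun y ↦ hField g y μ ν α) =ᶠ[𝓝 x]
      fun y ↦ (16 * Real.pi)⁻¹ * ∑ β, ((-(metricDet g y * (∑ t1, ∑ t2, upper g y t1 t2 * fderiv ℝ g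
        y (𝐞 β) (𝐞 t2) (𝐞 t1)))) * (upper g y μ ν * upper g y β α - upper g y β ν * upper g y μ α) +
        metricDet g y * ((∑ v1, ∑ v2, upper g y μ v1 * upper g y v2 ν * fderiv ℝ g y (𝐞 β) (𝐞 v1) (𝐞
        v2)) * upper g y β α + upper g y μ ν * (∑ v1, ∑ v2, upper g y β v1 * upper g y v2 α * fderiv
        ℝ g y (𝐞 β) (𝐞 v1) (𝐞 v2)) - (∑ v1, ∑ v2, upper g y β v1 * upper g y v2 ν * fderiv ℝ g y (𝐞
        β) (𝐞 v1) (𝐞 v2)) * upper g y μ α - upper g y β ν * (∑ v1, ∑ v2, upper g y μ v1 * upper g y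
        v2 α * fderiv ℝ g y (𝐞 β) (𝐞 v1) (𝐞 v2)))) := by
  filter_upwards [eventually_differentiableAt hg, eventually_metricDet_ne_zero hg hdet] with y hy hdy
  unfold hField
  congr 1
  exact Finset.sum_congr rfl fun β _ ↦ fderiv_superpotential hy hdy μ ν α β

/-- The trace piece `Σ g^{ρσ} ∂_β g_{σρ}` of Jacobi's formula and its derivative along `∂_α` at `x`. [cite: LandauLifshitz1975, §96 (96.2)] -/
theorem fderiv_trace_piece (hg : ContDiffAt ℝ 2 g x) (hdet : metricDet g x ≠ 0) (α β : Fin 4) :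
    DifferentiableAt ℝ (fun y ↦
      ∑ t1, ∑ t2, upper g y t1 t2 * fderiv ℝ g y (𝐞 β) (𝐞 t2) (𝐞 t1)) x ∧
    fderiv ℝ (fun y ↦
      ∑ t1, ∑ t2, upper g y t1 t2 * fderiv ℝ g y (𝐞 β) (𝐞 t2) (𝐞 t1)) x (𝐞 α) =
      (∑ t1, ∑ t2, -((∑ v1, ∑ v2, upper g x t1 v1 * upper g x v2 t2 * fderiv ℝ g x (𝐞 α) (𝐞 v1) (𝐞
        v2)) * fderiv ℝ g x (𝐞 β) (𝐞 t2) (𝐞 t1))) + (∑ t1, ∑ t2, upper g x t1 t2 * fderiv ℝ (fderiv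
        ℝ g) x (𝐞 α) (𝐞 β) (𝐞 t2) (𝐞 t1)) := by
  have hgx := differentiableAt_of_contDiffAt hg
  have hu : ∀ i j, HasFDerivAt (fun z ↦ upper g z i j) (fderiv ℝ (fun z ↦ upper g z i j) x) x :=
    fun i j ↦ (differentiableAt_upper hgx hdet i j).hasFDerivAt
  have hd : ∀ a i j, HasFDerivAt (fun y ↦ fderiv ℝ g y (𝐞 a) (𝐞 i) (𝐞 j))
      (fderiv ℝ (fun y ↦ fderiv ℝ g y (𝐞 a) (𝐞 i) (𝐞 j)) x) x :=
    fun a i j ↦ (differentiableAt_fderiv_apply₃ hg (𝐞 a) (𝐞 i) (𝐞 j)).hasFDerivAt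
  have h : HasFDerivAt (fun y ↦
      ∑ t1, ∑ t2, upper g y t1 t2 * fderiv ℝ g y (𝐞 β) (𝐞 t2) (𝐞 t1)) _ x :=
    (HasFDerivAt.fun_sum fun t1 _ ↦ (HasFDerivAt.fun_sum fun t2 _ ↦ (((hu t1 t2)).fun_mul (hd β t2 t1))))
  refine ⟨h.differentiableAt, ?_⟩
  rw [h.fderiv]
  simp only [_root_.add_apply, _root_.sub_apply, _root_.neg_apply, _root_.smul_apply,
    _root_.sum_apply, smul_eq_mul, fderiv_upper hgx hdet, fderiv_fderiv_apply₃ hg]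
  simp only [Fin.sum_univ_four]
  ring

/-- The piece `(g⁻¹ ∂_β g g⁻¹)_{ij}` (minus the derivative of `g^{ij}`) and its derivative along `∂_α` at `x`. [cite: LandauLifshitz1975, §96 (96.2)] -/
theorem fderiv_inv_piece (hg : ContDiffAt ℝ 2 g x) (hdet : metricDet g x ≠ 0) (α β i j : Fin 4) :
    DifferentiableAt ℝ (fun y ↦
      ∑ v1, ∑ v2, upper g y i v1 * upper g y v2 j * fderiv ℝ g y (𝐞 β) (𝐞 v1) (𝐞 v2)) x ∧
    fderiv ℝ (fun y ↦
      ∑ v1, ∑ v2, upper g y i v1 * upper g y v2 j * fderiv ℝ g y (𝐞 β) (𝐞 v1) (𝐞 v2)) x (𝐞 α) =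
      (∑ w1, ∑ w2, (-((∑ v1, ∑ v2, upper g x i v1 * upper g x v2 w1 * fderiv ℝ g x (𝐞 α) (𝐞 v1) (𝐞
        v2)) * upper g x w2 j * fderiv ℝ g x (𝐞 β) (𝐞 w1) (𝐞 w2)) - upper g x i w1 * (∑ v1, ∑ v2,
        upper g x w2 v1 * upper g x v2 j * fderiv ℝ g x (𝐞 α) (𝐞 v1) (𝐞 v2)) * fderiv ℝ g x (𝐞 β) (𝐞
        w1) (𝐞 w2))) + (∑ w1, ∑ w2, upper g x i w1 * upper g x w2 j * fderiv ℝ (fderiv ℝ g) x (𝐞 α)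
        (𝐞 β) (𝐞 w1) (𝐞 w2)) := by
  have hgx := differentiableAt_of_contDiffAt hg
  have hu : ∀ i j, HasFDerivAt (fun z ↦ upper g z i j) (fderiv ℝ (fun z ↦ upper g z i j) x) x :=
    fun i j ↦ (differentiableAt_upper hgx hdet i j).hasFDerivAt
  have hd : ∀ a i j, HasFDerivAt (fun y ↦ fderiv ℝ g y (𝐞 a) (𝐞 i) (𝐞 j))
      (fderiv ℝ (fun y ↦ fderiv ℝ g y (𝐞 a) (𝐞 i) (𝐞 j)) x) x :=
    fun a i j ↦ (differentiableAt_fderiv_apply₃ hg (𝐞 a) (𝐞 i) (𝐞 j)).hasFDerivAt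
  have h : HasFDerivAt (fun y ↦
      ∑ v1, ∑ v2, upper g y i v1 * upper g y v2 j * fderiv ℝ g y (𝐞 β) (𝐞 v1) (𝐞 v2)) _ x :=
    (HasFDerivAt.fun_sum fun v1 _ ↦ (HasFDerivAt.fun_sum fun v2 _ ↦ (((((hu i v1)).fun_mul (hu v2 j))).fun_mul (hd β v1 v2))))
  refine ⟨h.differentiableAt, ?_⟩
  rw [h.fderiv]
  simp only [_root_.add_apply, _root_.sub_apply, _root_.neg_apply, _root_.smul_apply,
    _root_.sum_apply, smul_eq_mul, fderiv_upper hgx hdet, fderiv_fderiv_apply₃ hg]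
  simp only [Fin.sum_univ_four]
  ring

/-- The `2 × 2` minor `g^{μν}g^{βα} − g^{βν}g^{μα}` of the inverse and its derivative along `∂_α` at `x`. [cite: LandauLifshitz1975, §96 (96.2)] -/
theorem fderiv_minor_piece (hg : ContDiffAt ℝ 2 g x) (hdet : metricDet g x ≠ 0) (μ ν α β : Fin 4) :
    DifferentiableAt ℝ (fun y ↦
      upper g y μ ν * upper g y β α - upper g y β ν * upper g y μ α) x ∧
    fderiv ℝ (fun y ↦
      upper g y μ ν * upper g y β α - upper g y β ν * upper g y μ α) x (𝐞 α) =
      -((∑ v1, ∑ v2, upper g x μ v1 * upper g x v2 ν * fderiv ℝ g x (𝐞 α) (𝐞 v1) (𝐞 v2)) * upper g x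
        β α + upper g x μ ν * (∑ v1, ∑ v2, upper g x β v1 * upper g x v2 α * fderiv ℝ g x (𝐞 α) (𝐞
        v1) (𝐞 v2)) - (∑ v1, ∑ v2, upper g x β v1 * upper g x v2 ν * fderiv ℝ g x (𝐞 α) (𝐞 v1) (𝐞
        v2)) * upper g x μ α - upper g x β ν * (∑ v1, ∑ v2, upper g x μ v1 * upper g x v2 α * fderiv
        ℝ g x (𝐞 α) (𝐞 v1) (𝐞 v2))) := by
  have hgx := differentiableAt_of_contDiffAt hg
  have hu : ∀ i j, HasFDerivAt (fun z ↦ upper g z i j) (fderiv ℝ (fun z ↦ upper g z i j) x) x :=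
    fun i j ↦ (differentiableAt_upper hgx hdet i j).hasFDerivAt
  have hd : ∀ a i j, HasFDerivAt (fun y ↦ fderiv ℝ g y (𝐞 a) (𝐞 i) (𝐞 j))
      (fderiv ℝ (fun y ↦ fderiv ℝ g y (𝐞 a) (𝐞 i) (𝐞 j)) x) x :=
    fun a i j ↦ (differentiableAt_fderiv_apply₃ hg (𝐞 a) (𝐞 i) (𝐞 j)).hasFDerivAt
  have h : HasFDerivAt (fun y ↦
      upper g y μ ν * upper g y β α - upper g y β ν * upper g y μ α) _ x :=
    (((((hu μ ν)).fun_mul (hu β α))).fun_sub (((hu β ν)).fun_mul (hu μ α)))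
  refine ⟨h.differentiableAt, ?_⟩
  rw [h.fderiv]
  simp only [_root_.add_apply, _root_.sub_apply, _root_.neg_apply, _root_.smul_apply,
    _root_.sum_apply, smul_eq_mul, fderiv_upper hgx hdet, fderiv_fderiv_apply₃ hg]
  simp only [Fin.sum_univ_four]
  ring

/-- The first-derivative piece `Σ ±(g⁻¹∂_β g g⁻¹)·g⁻¹` of `∂_β H` and its derivative along `∂_α`
at `x`. [cite: LandauLifshitz1975, §96 (96.2)] -/
theorem fderiv_quad_piece (hg : ContDiffAt ℝ 2 g x) (hdet : metricDet g x ≠ 0) (μ ν α β : Fin 4) :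
    DifferentiableAt ℝ (fun y ↦
      (∑ v1, ∑ v2, upper g y μ v1 * upper g y v2 ν * fderiv ℝ g y (𝐞 β) (𝐞 v1) (𝐞 v2)) * upper g y β
        α + upper g y μ ν * (∑ v1, ∑ v2, upper g y β v1 * upper g y v2 α * fderiv ℝ g y (𝐞 β) (𝐞 v1)
        (𝐞 v2)) - (∑ v1, ∑ v2, upper g y β v1 * upper g y v2 ν * fderiv ℝ g y (𝐞 β) (𝐞 v1) (𝐞 v2)) *
        upper g y μ α - upper g y β ν * (∑ v1, ∑ v2, upper g y μ v1 * upper g y v2 α * fderiv ℝ g y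
        (𝐞 β) (𝐞 v1) (𝐞 v2))) x ∧
    fderiv ℝ (fun y ↦
      (∑ v1, ∑ v2, upper g y μ v1 * upper g y v2 ν * fderiv ℝ g y (𝐞 β) (𝐞 v1) (𝐞 v2)) * upper g y β
        α + upper g y μ ν * (∑ v1, ∑ v2, upper g y β v1 * upper g y v2 α * fderiv ℝ g y (𝐞 β) (𝐞 v1)
        (𝐞 v2)) - (∑ v1, ∑ v2, upper g y β v1 * upper g y v2 ν * fderiv ℝ g y (𝐞 β) (𝐞 v1) (𝐞 v2)) *
        upper g y μ α - upper g y β ν * (∑ v1, ∑ v2, upper g y μ v1 * upper g y v2 α * fderiv ℝ g y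
        (𝐞 β) (𝐞 v1) (𝐞 v2))) x (𝐞 α) =
      (∑ w1, ∑ w2, (-((∑ v1, ∑ v2, upper g x μ v1 * upper g x v2 w1 * fderiv ℝ g x (𝐞 α) (𝐞 v1) (𝐞
        v2)) * upper g x w2 ν * fderiv ℝ g x (𝐞 β) (𝐞 w1) (𝐞 w2)) - upper g x μ w1 * (∑ v1, ∑ v2,
        upper g x w2 v1 * upper g x v2 ν * fderiv ℝ g x (𝐞 α) (𝐞 v1) (𝐞 v2)) * fderiv ℝ g x (𝐞 β) (𝐞
        w1) (𝐞 w2))) * upper g x β α + (∑ v1, ∑ v2, upper g x μ v1 * upper g x v2 ν * fderiv ℝ g x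
        (𝐞 β) (𝐞 v1) (𝐞 v2)) * (-(∑ v1, ∑ v2, upper g x β v1 * upper g x v2 α * fderiv ℝ g x (𝐞 α)
        (𝐞 v1) (𝐞 v2))) + (-(∑ v1, ∑ v2, upper g x μ v1 * upper g x v2 ν * fderiv ℝ g x (𝐞 α) (𝐞 v1)
        (𝐞 v2))) * (∑ v1, ∑ v2, upper g x β v1 * upper g x v2 α * fderiv ℝ g x (𝐞 β) (𝐞 v1) (𝐞 v2))
        + upper g x μ ν * (∑ w1, ∑ w2, (-((∑ v1, ∑ v2, upper g x β v1 * upper g x v2 w1 * fderiv ℝ g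
        x (𝐞 α) (𝐞 v1) (𝐞 v2)) * upper g x w2 α * fderiv ℝ g x (𝐞 β) (𝐞 w1) (𝐞 w2)) - upper g x β w1
        * (∑ v1, ∑ v2, upper g x w2 v1 * upper g x v2 α * fderiv ℝ g x (𝐞 α) (𝐞 v1) (𝐞 v2)) * fderiv
        ℝ g x (𝐞 β) (𝐞 w1) (𝐞 w2))) - (∑ w1, ∑ w2, (-((∑ v1, ∑ v2, upper g x β v1 * upper g x v2 w1
        * fderiv ℝ g x (𝐞 α) (𝐞 v1) (𝐞 v2)) * upper g x w2 ν * fderiv ℝ g x (𝐞 β) (𝐞 w1) (𝐞 w2)) -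
        upper g x β w1 * (∑ v1, ∑ v2, upper g x w2 v1 * upper g x v2 ν * fderiv ℝ g x (𝐞 α) (𝐞 v1)
        (𝐞 v2)) * fderiv ℝ g x (𝐞 β) (𝐞 w1) (𝐞 w2))) * upper g x μ α - (∑ v1, ∑ v2, upper g x β v1 *
        upper g x v2 ν * fderiv ℝ g x (𝐞 β) (𝐞 v1) (𝐞 v2)) * (-(∑ v1, ∑ v2, upper g x μ v1 * upper g
        x v2 α * fderiv ℝ g x (𝐞 α) (𝐞 v1) (𝐞 v2))) - (-(∑ v1, ∑ v2, upper g x β v1 * upper g x v2 ν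
        * fderiv ℝ g x (𝐞 α) (𝐞 v1) (𝐞 v2))) * (∑ v1, ∑ v2, upper g x μ v1 * upper g x v2 α * fderiv
        ℝ g x (𝐞 β) (𝐞 v1) (𝐞 v2)) - upper g x β ν * (∑ w1, ∑ w2, (-((∑ v1, ∑ v2, upper g x μ v1 *
        upper g x v2 w1 * fderiv ℝ g x (𝐞 α) (𝐞 v1) (𝐞 v2)) * upper g x w2 α * fderiv ℝ g x (𝐞 β) (𝐞
        w1) (𝐞 w2)) - upper g x μ w1 * (∑ v1, ∑ v2, upper g x w2 v1 * upper g x v2 α * fderiv ℝ g x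
        (𝐞 α) (𝐞 v1) (𝐞 v2)) * fderiv ℝ g x (𝐞 β) (𝐞 w1) (𝐞 w2))) + ((∑ w1, ∑ w2, upper g x μ w1 *
        upper g x w2 ν * fderiv ℝ (fderiv ℝ g) x (𝐞 α) (𝐞 β) (𝐞 w1) (𝐞 w2)) * upper g x β α + upper
        g x μ ν * (∑ w1, ∑ w2, upper g x β w1 * upper g x w2 α * fderiv ℝ (fderiv ℝ g) x (𝐞 α) (𝐞 β)
        (𝐞 w1) (𝐞 w2)) - (∑ w1, ∑ w2, upper g x β w1 * upper g x w2 ν * fderiv ℝ (fderiv ℝ g) x (𝐞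
        α) (𝐞 β) (𝐞 w1) (𝐞 w2)) * upper g x μ α - upper g x β ν * (∑ w1, ∑ w2, upper g x μ w1 *
        upper g x w2 α * fderiv ℝ (fderiv ℝ g) x (𝐞 α) (𝐞 β) (𝐞 w1) (𝐞 w2))) := by
  have hgx := differentiableAt_of_contDiffAt hg
  have hu : ∀ i j, HasFDerivAt (fun z ↦ upper g z i j) (fderiv ℝ (fun z ↦ upper g z i j) x) x :=
    fun i j ↦ (differentiableAt_upper hgx hdet i j).hasFDerivAt
  have hd : ∀ a i j, HasFDerivAt (fun y ↦ fderiv ℝ g y (𝐞 a) (𝐞 i) (𝐞 j))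
      (fderiv ℝ (fun y ↦ fderiv ℝ g y (𝐞 a) (𝐞 i) (𝐞 j)) x) x :=
    fun a i j ↦ (differentiableAt_fderiv_apply₃ hg (𝐞 a) (𝐞 i) (𝐞 j)).hasFDerivAt
  have hV : ∀ i j, HasFDerivAt (fun y ↦
      ∑ v1, ∑ v2, upper g y i v1 * upper g y v2 j * fderiv ℝ g y (𝐞 β) (𝐞 v1) (𝐞 v2))
      (fderiv ℝ (fun y ↦
        ∑ v1, ∑ v2, upper g y i v1 * upper g y v2 j * fderiv ℝ g y (𝐞 β) (𝐞 v1) (𝐞 v2)) x) x :=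
    fun i j ↦ (fderiv_inv_piece hg hdet α β i j).1.hasFDerivAt
  have hVv : ∀ i j, fderiv ℝ (fun y ↦
      ∑ v1, ∑ v2, upper g y i v1 * upper g y v2 j * fderiv ℝ g y (𝐞 β) (𝐞 v1) (𝐞 v2)) x (𝐞 α) =
      (∑ w1, ∑ w2, (-((∑ v1, ∑ v2, upper g x i v1 * upper g x v2 w1 * fderiv ℝ g x (𝐞 α) (𝐞 v1) (𝐞
        v2)) * upper g x w2 j * fderiv ℝ g x (𝐞 β) (𝐞 w1) (𝐞 w2)) - upper g x i w1 * (∑ v1, ∑ v2,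
        upper g x w2 v1 * upper g x v2 j * fderiv ℝ g x (𝐞 α) (𝐞 v1) (𝐞 v2)) * fderiv ℝ g x (𝐞 β) (𝐞
        w1) (𝐞 w2))) + (∑ w1, ∑ w2, upper g x i w1 * upper g x w2 j * fderiv ℝ (fderiv ℝ g) x (𝐞 α)
        (𝐞 β) (𝐞 w1) (𝐞 w2)) :=
    fun i j ↦ (fderiv_inv_piece hg hdet α β i j).2
  have h : HasFDerivAt (fun y ↦
      (∑ v1, ∑ v2, upper g y μ v1 * upper g y v2 ν * fderiv ℝ g y (𝐞 β) (𝐞 v1) (𝐞 v2)) * upper g y β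
        α + upper g y μ ν * (∑ v1, ∑ v2, upper g y β v1 * upper g y v2 α * fderiv ℝ g y (𝐞 β) (𝐞 v1)
        (𝐞 v2)) - (∑ v1, ∑ v2, upper g y β v1 * upper g y v2 ν * fderiv ℝ g y (𝐞 β) (𝐞 v1) (𝐞 v2)) *
        upper g y μ α - upper g y β ν * (∑ v1, ∑ v2, upper g y μ v1 * upper g y v2 α * fderiv ℝ g y
        (𝐞 β) (𝐞 v1) (𝐞 v2))) _ x :=
    (((((hV μ ν).fun_mul (hu β α)).fun_add ((hu μ ν).fun_mul (hV β α))).fun_sub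
      ((hV β ν).fun_mul (hu μ α))).fun_sub ((hu β ν).fun_mul (hV μ α)))
  refine ⟨h.differentiableAt, ?_⟩
  rw [h.fderiv]
  simp only [_root_.add_apply, _root_.sub_apply, _root_.neg_apply, _root_.smul_apply, smul_eq_mul,
    fderiv_upper hgx hdet, hVv]
  ring

/-- **`∂_α ∂_β H^{μβνα}(x)` in the `2`-jet**, split as (linear in `∂∂g`) + (quadratic in `∂g`):
the derivative along `∂_α` at `x` of the expansion of `∂_β H^{μβνα}` (`fderiv_superpotential`).
[cite: LandauLifshitz1975, §96 (96.8)] -/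
theorem fderiv_dSuperpotential (hg : ContDiffAt ℝ 2 g x) (hdet : metricDet g x ≠ 0)
    (μ ν α β : Fin 4) :
    DifferentiableAt ℝ (fun y ↦
      (-(metricDet g y * (∑ t1, ∑ t2, upper g y t1 t2 * fderiv ℝ g y (𝐞 β) (𝐞 t2) (𝐞 t1)))) * (upper
        g y μ ν * upper g y β α - upper g y β ν * upper g y μ α) + metricDet g y * ((∑ v1, ∑ v2,
        upper g y μ v1 * upper g y v2 ν * fderiv ℝ g y (𝐞 β) (𝐞 v1) (𝐞 v2)) * upper g y β α + upper
        g y μ ν * (∑ v1, ∑ v2, upper g y β v1 * upper g y v2 α * fderiv ℝ g y (𝐞 β) (𝐞 v1) (𝐞 v2)) -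
        (∑ v1, ∑ v2, upper g y β v1 * upper g y v2 ν * fderiv ℝ g y (𝐞 β) (𝐞 v1) (𝐞 v2)) * upper g y
        μ α - upper g y β ν * (∑ v1, ∑ v2, upper g y μ v1 * upper g y v2 α * fderiv ℝ g y (𝐞 β) (𝐞
        v1) (𝐞 v2)))) x ∧
    fderiv ℝ (fun y ↦
      (-(metricDet g y * (∑ t1, ∑ t2, upper g y t1 t2 * fderiv ℝ g y (𝐞 β) (𝐞 t2) (𝐞 t1)))) * (upper
        g y μ ν * upper g y β α - upper g y β ν * upper g y μ α) + metricDet g y * ((∑ v1, ∑ v2,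
        upper g y μ v1 * upper g y v2 ν * fderiv ℝ g y (𝐞 β) (𝐞 v1) (𝐞 v2)) * upper g y β α + upper
        g y μ ν * (∑ v1, ∑ v2, upper g y β v1 * upper g y v2 α * fderiv ℝ g y (𝐞 β) (𝐞 v1) (𝐞 v2)) -
        (∑ v1, ∑ v2, upper g y β v1 * upper g y v2 ν * fderiv ℝ g y (𝐞 β) (𝐞 v1) (𝐞 v2)) * upper g y
        μ α - upper g y β ν * (∑ v1, ∑ v2, upper g y μ v1 * upper g y v2 α * fderiv ℝ g y (𝐞 β) (𝐞
        v1) (𝐞 v2)))) x (𝐞 α) =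
      (-(metricDet g x * (∑ t1, ∑ t2, upper g x t1 t2 * fderiv ℝ (fderiv ℝ g) x (𝐞 α) (𝐞 β) (𝐞 t2)
        (𝐞 t1)))) * (upper g x μ ν * upper g x β α - upper g x β ν * upper g x μ α) + metricDet g x
        * ((∑ w1, ∑ w2, upper g x μ w1 * upper g x w2 ν * fderiv ℝ (fderiv ℝ g) x (𝐞 α) (𝐞 β) (𝐞 w1)
        (𝐞 w2)) * upper g x β α + upper g x μ ν * (∑ w1, ∑ w2, upper g x β w1 * upper g x w2 α *
        fderiv ℝ (fderiv ℝ g) x (𝐞 α) (𝐞 β) (𝐞 w1) (𝐞 w2)) - (∑ w1, ∑ w2, upper g x β w1 * upper g x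
        w2 ν * fderiv ℝ (fderiv ℝ g) x (𝐞 α) (𝐞 β) (𝐞 w1) (𝐞 w2)) * upper g x μ α - upper g x β ν *
        (∑ w1, ∑ w2, upper g x μ w1 * upper g x w2 α * fderiv ℝ (fderiv ℝ g) x (𝐞 α) (𝐞 β) (𝐞 w1) (𝐞
        w2)))
      +
      ((-(metricDet g x * (∑ t1, ∑ t2, upper g x t1 t2 * fderiv ℝ g x (𝐞 α) (𝐞 t2) (𝐞 t1)) * (∑ t1,
        ∑ t2, upper g x t1 t2 * fderiv ℝ g x (𝐞 β) (𝐞 t2) (𝐞 t1)) + metricDet g x * (∑ t1, ∑ t2,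
        -((∑ v1, ∑ v2, upper g x t1 v1 * upper g x v2 t2 * fderiv ℝ g x (𝐞 α) (𝐞 v1) (𝐞 v2)) *
        fderiv ℝ g x (𝐞 β) (𝐞 t2) (𝐞 t1))))) * (upper g x μ ν * upper g x β α - upper g x β ν *
        upper g x μ α) + metricDet g x * (∑ t1, ∑ t2, upper g x t1 t2 * fderiv ℝ g x (𝐞 β) (𝐞 t2) (𝐞
        t1)) * ((∑ v1, ∑ v2, upper g x μ v1 * upper g x v2 ν * fderiv ℝ g x (𝐞 α) (𝐞 v1) (𝐞 v2)) *
        upper g x β α + upper g x μ ν * (∑ v1, ∑ v2, upper g x β v1 * upper g x v2 α * fderiv ℝ g x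
        (𝐞 α) (𝐞 v1) (𝐞 v2)) - (∑ v1, ∑ v2, upper g x β v1 * upper g x v2 ν * fderiv ℝ g x (𝐞 α) (𝐞
        v1) (𝐞 v2)) * upper g x μ α - upper g x β ν * (∑ v1, ∑ v2, upper g x μ v1 * upper g x v2 α *
        fderiv ℝ g x (𝐞 α) (𝐞 v1) (𝐞 v2))) + metricDet g x * (∑ t1, ∑ t2, upper g x t1 t2 * fderiv ℝ
        g x (𝐞 α) (𝐞 t2) (𝐞 t1)) * ((∑ v1, ∑ v2, upper g x μ v1 * upper g x v2 ν * fderiv ℝ g x (𝐞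
        β) (𝐞 v1) (𝐞 v2)) * upper g x β α + upper g x μ ν * (∑ v1, ∑ v2, upper g x β v1 * upper g x
        v2 α * fderiv ℝ g x (𝐞 β) (𝐞 v1) (𝐞 v2)) - (∑ v1, ∑ v2, upper g x β v1 * upper g x v2 ν *
        fderiv ℝ g x (𝐞 β) (𝐞 v1) (𝐞 v2)) * upper g x μ α - upper g x β ν * (∑ v1, ∑ v2, upper g x μ
        v1 * upper g x v2 α * fderiv ℝ g x (𝐞 β) (𝐞 v1) (𝐞 v2))) + metricDet g x * ((∑ w1, ∑ w2,
        (-((∑ v1, ∑ v2, upper g x μ v1 * upper g x v2 w1 * fderiv ℝ g x (𝐞 α) (𝐞 v1) (𝐞 v2)) * upper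
        g x w2 ν * fderiv ℝ g x (𝐞 β) (𝐞 w1) (𝐞 w2)) - upper g x μ w1 * (∑ v1, ∑ v2, upper g x w2 v1
        * upper g x v2 ν * fderiv ℝ g x (𝐞 α) (𝐞 v1) (𝐞 v2)) * fderiv ℝ g x (𝐞 β) (𝐞 w1) (𝐞 w2))) *
        upper g x β α + (∑ v1, ∑ v2, upper g x μ v1 * upper g x v2 ν * fderiv ℝ g x (𝐞 β) (𝐞 v1) (𝐞
        v2)) * (-(∑ v1, ∑ v2, upper g x β v1 * upper g x v2 α * fderiv ℝ g x (𝐞 α) (𝐞 v1) (𝐞 v2))) +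
        (-(∑ v1, ∑ v2, upper g x μ v1 * upper g x v2 ν * fderiv ℝ g x (𝐞 α) (𝐞 v1) (𝐞 v2))) * (∑ v1,
        ∑ v2, upper g x β v1 * upper g x v2 α * fderiv ℝ g x (𝐞 β) (𝐞 v1) (𝐞 v2)) + upper g x μ ν *
        (∑ w1, ∑ w2, (-((∑ v1, ∑ v2, upper g x β v1 * upper g x v2 w1 * fderiv ℝ g x (𝐞 α) (𝐞 v1) (𝐞
        v2)) * upper g x w2 α * fderiv ℝ g x (𝐞 β) (𝐞 w1) (𝐞 w2)) - upper g x β w1 * (∑ v1, ∑ v2,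
        upper g x w2 v1 * upper g x v2 α * fderiv ℝ g x (𝐞 α) (𝐞 v1) (𝐞 v2)) * fderiv ℝ g x (𝐞 β) (𝐞
        w1) (𝐞 w2))) - (∑ w1, ∑ w2, (-((∑ v1, ∑ v2, upper g x β v1 * upper g x v2 w1 * fderiv ℝ g x
        (𝐞 α) (𝐞 v1) (𝐞 v2)) * upper g x w2 ν * fderiv ℝ g x (𝐞 β) (𝐞 w1) (𝐞 w2)) - upper g x β w1 *
        (∑ v1, ∑ v2, upper g x w2 v1 * upper g x v2 ν * fderiv ℝ g x (𝐞 α) (𝐞 v1) (𝐞 v2)) * fderiv ℝ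
        g x (𝐞 β) (𝐞 w1) (𝐞 w2))) * upper g x μ α - (∑ v1, ∑ v2, upper g x β v1 * upper g x v2 ν *
        fderiv ℝ g x (𝐞 β) (𝐞 v1) (𝐞 v2)) * (-(∑ v1, ∑ v2, upper g x μ v1 * upper g x v2 α * fderiv
        ℝ g x (𝐞 α) (𝐞 v1) (𝐞 v2))) - (-(∑ v1, ∑ v2, upper g x β v1 * upper g x v2 ν * fderiv ℝ g x
        (𝐞 α) (𝐞 v1) (𝐞 v2))) * (∑ v1, ∑ v2, upper g x μ v1 * upper g x v2 α * fderiv ℝ g x (𝐞 β) (𝐞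
        v1) (𝐞 v2)) - upper g x β ν * (∑ w1, ∑ w2, (-((∑ v1, ∑ v2, upper g x μ v1 * upper g x v2 w1
        * fderiv ℝ g x (𝐞 α) (𝐞 v1) (𝐞 v2)) * upper g x w2 α * fderiv ℝ g x (𝐞 β) (𝐞 w1) (𝐞 w2)) -
        upper g x μ w1 * (∑ v1, ∑ v2, upper g x w2 v1 * upper g x v2 α * fderiv ℝ g x (𝐞 α) (𝐞 v1)
        (𝐞 v2)) * fderiv ℝ g x (𝐞 β) (𝐞 w1) (𝐞 w2))))) := by
  have hgx := differentiableAt_of_contDiffAt hg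
  have hD : HasFDerivAt (fun y ↦ metricDet g y) (fderiv ℝ (metricDet g) x) x :=
    (differentiableAt_metricDet hgx).hasFDerivAt
  have hT := fderiv_trace_piece hg hdet α β
  have hq := fderiv_minor_piece hg hdet μ ν α β
  have hQ := fderiv_quad_piece hg hdet μ ν α β
  have h : HasFDerivAt (fun y ↦
      (-(metricDet g y * (∑ t1, ∑ t2, upper g y t1 t2 * fderiv ℝ g y (𝐞 β) (𝐞 t2) (𝐞 t1)))) * (upper
        g y μ ν * upper g y β α - upper g y β ν * upper g y μ α) + metricDet g y * ((∑ v1, ∑ v2,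
        upper g y μ v1 * upper g y v2 ν * fderiv ℝ g y (𝐞 β) (𝐞 v1) (𝐞 v2)) * upper g y β α + upper
        g y μ ν * (∑ v1, ∑ v2, upper g y β v1 * upper g y v2 α * fderiv ℝ g y (𝐞 β) (𝐞 v1) (𝐞 v2)) -
        (∑ v1, ∑ v2, upper g y β v1 * upper g y v2 ν * fderiv ℝ g y (𝐞 β) (𝐞 v1) (𝐞 v2)) * upper g y
        μ α - upper g y β ν * (∑ v1, ∑ v2, upper g y μ v1 * upper g y v2 α * fderiv ℝ g y (𝐞 β) (𝐞
        v1) (𝐞 v2)))) _ x :=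
    ((hD.fun_mul hT.1.hasFDerivAt).fun_neg.fun_mul hq.1.hasFDerivAt).fun_add
      (hD.fun_mul hQ.1.hasFDerivAt)
  refine ⟨h.differentiableAt, ?_⟩
  rw [h.fderiv]
  simp only [_root_.add_apply, _root_.sub_apply, _root_.neg_apply, _root_.smul_apply, smul_eq_mul,
    fderiv_metricDet hgx hdet, hT.2, hq.2, hQ.2]
  ring

/-- **The Landau–Lifshitz complex in the `2`-jet of the components.** For `g` of class `C²` at `x`
with `det (g_{μν}(x)) ≠ 0`:
`Σ_α ∂_α h^{μνα}(x) = Σ_α (16π)⁻¹ Σ_β [LIN^{μν}_{αβ}(∂∂g) + QUAD^{μν}_{αβ}(∂g, ∂g)]` with the displayed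
explicit polynomials in `det g`, `g^{ij}`, `∂g`, `∂∂g` at `x` (LL (96.5) expanded; after the
cancellation of `LIN` against the `∂∂g`-part of `(det g) G^{μν}/(8π)` in part 5, `−(16π)⁻¹ Σ QUAD` and the
quadratic part of `−(8π)⁻¹ (det g) G^{μν}` make up `(det g) · t^{μν}_LL`, LL (96.8)).
[cite: LandauLifshitz1975, §96 (96.5)] -/
theorem emComplex_eq_twoJet (hg : ContDiffAt ℝ 2 g x) (hdet : metricDet g x ≠ 0) (μ ν : Fin 4) :
    emComplex g x μ ν = ∑ α, (16 * Real.pi)⁻¹ * ∑ β,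
      (
      (-(metricDet g x * (∑ t1, ∑ t2, upper g x t1 t2 * fderiv ℝ (fderiv ℝ g) x (𝐞 α) (𝐞 β) (𝐞 t2)
        (𝐞 t1)))) * (upper g x μ ν * upper g x β α - upper g x β ν * upper g x μ α) + metricDet g x
        * ((∑ w1, ∑ w2, upper g x μ w1 * upper g x w2 ν * fderiv ℝ (fderiv ℝ g) x (𝐞 α) (𝐞 β) (𝐞 w1)
        (𝐞 w2)) * upper g x β α + upper g x μ ν * (∑ w1, ∑ w2, upper g x β w1 * upper g x w2 α *
        fderiv ℝ (fderiv ℝ g) x (𝐞 α) (𝐞 β) (𝐞 w1) (𝐞 w2)) - (∑ w1, ∑ w2, upper g x β w1 * upper g x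
        w2 ν * fderiv ℝ (fderiv ℝ g) x (𝐞 α) (𝐞 β) (𝐞 w1) (𝐞 w2)) * upper g x μ α - upper g x β ν *
        (∑ w1, ∑ w2, upper g x μ w1 * upper g x w2 α * fderiv ℝ (fderiv ℝ g) x (𝐞 α) (𝐞 β) (𝐞 w1) (𝐞
        w2)))
      +
      ((-(metricDet g x * (∑ t1, ∑ t2, upper g x t1 t2 * fderiv ℝ g x (𝐞 α) (𝐞 t2) (𝐞 t1)) * (∑ t1,
        ∑ t2, upper g x t1 t2 * fderiv ℝ g x (𝐞 β) (𝐞 t2) (𝐞 t1)) + metricDet g x * (∑ t1, ∑ t2,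
        -((∑ v1, ∑ v2, upper g x t1 v1 * upper g x v2 t2 * fderiv ℝ g x (𝐞 α) (𝐞 v1) (𝐞 v2)) *
        fderiv ℝ g x (𝐞 β) (𝐞 t2) (𝐞 t1))))) * (upper g x μ ν * upper g x β α - upper g x β ν *
        upper g x μ α) + metricDet g x * (∑ t1, ∑ t2, upper g x t1 t2 * fderiv ℝ g x (𝐞 β) (𝐞 t2) (𝐞
        t1)) * ((∑ v1, ∑ v2, upper g x μ v1 * upper g x v2 ν * fderiv ℝ g x (𝐞 α) (𝐞 v1) (𝐞 v2)) *
        upper g x β α + upper g x μ ν * (∑ v1, ∑ v2, upper g x β v1 * upper g x v2 α * fderiv ℝ g x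
        (𝐞 α) (𝐞 v1) (𝐞 v2)) - (∑ v1, ∑ v2, upper g x β v1 * upper g x v2 ν * fderiv ℝ g x (𝐞 α) (𝐞
        v1) (𝐞 v2)) * upper g x μ α - upper g x β ν * (∑ v1, ∑ v2, upper g x μ v1 * upper g x v2 α *
        fderiv ℝ g x (𝐞 α) (𝐞 v1) (𝐞 v2))) + metricDet g x * (∑ t1, ∑ t2, upper g x t1 t2 * fderiv ℝ
        g x (𝐞 α) (𝐞 t2) (𝐞 t1)) * ((∑ v1, ∑ v2, upper g x μ v1 * upper g x v2 ν * fderiv ℝ g x (𝐞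
        β) (𝐞 v1) (𝐞 v2)) * upper g x β α + upper g x μ ν * (∑ v1, ∑ v2, upper g x β v1 * upper g x
        v2 α * fderiv ℝ g x (𝐞 β) (𝐞 v1) (𝐞 v2)) - (∑ v1, ∑ v2, upper g x β v1 * upper g x v2 ν *
        fderiv ℝ g x (𝐞 β) (𝐞 v1) (𝐞 v2)) * upper g x μ α - upper g x β ν * (∑ v1, ∑ v2, upper g x μ
        v1 * upper g x v2 α * fderiv ℝ g x (𝐞 β) (𝐞 v1) (𝐞 v2))) + metricDet g x * ((∑ w1, ∑ w2,
        (-((∑ v1, ∑ v2, upper g x μ v1 * upper g x v2 w1 * fderiv ℝ g x (𝐞 α) (𝐞 v1) (𝐞 v2)) * upper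
        g x w2 ν * fderiv ℝ g x (𝐞 β) (𝐞 w1) (𝐞 w2)) - upper g x μ w1 * (∑ v1, ∑ v2, upper g x w2 v1
        * upper g x v2 ν * fderiv ℝ g x (𝐞 α) (𝐞 v1) (𝐞 v2)) * fderiv ℝ g x (𝐞 β) (𝐞 w1) (𝐞 w2))) *
        upper g x β α + (∑ v1, ∑ v2, upper g x μ v1 * upper g x v2 ν * fderiv ℝ g x (𝐞 β) (𝐞 v1) (𝐞
        v2)) * (-(∑ v1, ∑ v2, upper g x β v1 * upper g x v2 α * fderiv ℝ g x (𝐞 α) (𝐞 v1) (𝐞 v2))) +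
        (-(∑ v1, ∑ v2, upper g x μ v1 * upper g x v2 ν * fderiv ℝ g x (𝐞 α) (𝐞 v1) (𝐞 v2))) * (∑ v1,
        ∑ v2, upper g x β v1 * upper g x v2 α * fderiv ℝ g x (𝐞 β) (𝐞 v1) (𝐞 v2)) + upper g x μ ν *
        (∑ w1, ∑ w2, (-((∑ v1, ∑ v2, upper g x β v1 * upper g x v2 w1 * fderiv ℝ g x (𝐞 α) (𝐞 v1) (𝐞
        v2)) * upper g x w2 α * fderiv ℝ g x (𝐞 β) (𝐞 w1) (𝐞 w2)) - upper g x β w1 * (∑ v1, ∑ v2,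
        upper g x w2 v1 * upper g x v2 α * fderiv ℝ g x (𝐞 α) (𝐞 v1) (𝐞 v2)) * fderiv ℝ g x (𝐞 β) (𝐞
        w1) (𝐞 w2))) - (∑ w1, ∑ w2, (-((∑ v1, ∑ v2, upper g x β v1 * upper g x v2 w1 * fderiv ℝ g x
        (𝐞 α) (𝐞 v1) (𝐞 v2)) * upper g x w2 ν * fderiv ℝ g x (𝐞 β) (𝐞 w1) (𝐞 w2)) - upper g x β w1 *
        (∑ v1, ∑ v2, upper g x w2 v1 * upper g x v2 ν * fderiv ℝ g x (𝐞 α) (𝐞 v1) (𝐞 v2)) * fderiv ℝ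
        g x (𝐞 β) (𝐞 w1) (𝐞 w2))) * upper g x μ α - (∑ v1, ∑ v2, upper g x β v1 * upper g x v2 ν *
        fderiv ℝ g x (𝐞 β) (𝐞 v1) (𝐞 v2)) * (-(∑ v1, ∑ v2, upper g x μ v1 * upper g x v2 α * fderiv
        ℝ g x (𝐞 α) (𝐞 v1) (𝐞 v2))) - (-(∑ v1, ∑ v2, upper g x β v1 * upper g x v2 ν * fderiv ℝ g x
        (𝐞 α) (𝐞 v1) (𝐞 v2))) * (∑ v1, ∑ v2, upper g x μ v1 * upper g x v2 α * fderiv ℝ g x (𝐞 β) (𝐞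
        v1) (𝐞 v2)) - upper g x β ν * (∑ w1, ∑ w2, (-((∑ v1, ∑ v2, upper g x μ v1 * upper g x v2 w1
        * fderiv ℝ g x (𝐞 α) (𝐞 v1) (𝐞 v2)) * upper g x w2 α * fderiv ℝ g x (𝐞 β) (𝐞 w1) (𝐞 w2)) -
        upper g x μ w1 * (∑ v1, ∑ v2, upper g x w2 v1 * upper g x v2 α * fderiv ℝ g x (𝐞 α) (𝐞 v1)
        (𝐞 v2)) * fderiv ℝ g x (𝐞 β) (𝐞 w1) (𝐞 w2)))))) := by
  unfold emComplex partialDeriv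
  refine Finset.sum_congr rfl fun α _ ↦ ?_
  rw [(hField_eventuallyEq hg hdet μ ν α).fderiv_eq]
  have h : HasFDerivAt (
      fun y ↦ (16 * Real.pi)⁻¹ * ∑ β, ((-(metricDet g y * (∑ t1, ∑ t2, upper g y t1 t2 * fderiv ℝ g
        y (𝐞 β) (𝐞 t2) (𝐞 t1)))) * (upper g y μ ν * upper g y β α - upper g y β ν * upper g y μ α) +
        metricDet g y * ((∑ v1, ∑ v2, upper g y μ v1 * upper g y v2 ν * fderiv ℝ g y (𝐞 β) (𝐞 v1) (𝐞
        v2)) * upper g y β α + upper g y μ ν * (∑ v1, ∑ v2, upper g y β v1 * upper g y v2 α * fderiv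
        ℝ g y (𝐞 β) (𝐞 v1) (𝐞 v2)) - (∑ v1, ∑ v2, upper g y β v1 * upper g y v2 ν * fderiv ℝ g y (𝐞
        β) (𝐞 v1) (𝐞 v2)) * upper g y μ α - upper g y β ν * (∑ v1, ∑ v2, upper g y μ v1 * upper g y
        v2 α * fderiv ℝ g y (𝐞 β) (𝐞 v1) (𝐞 v2))))) _ x :=
    (HasFDerivAt.fun_sum fun β _ ↦ (fderiv_dSuperpotential hg hdet μ ν α β).1.hasFDerivAt).const_mul _
  rw [h.fderiv]
  simp only [_root_.smul_apply, _root_.sum_apply, smul_eq_mul]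
  congr 1
  exact Finset.sum_congr rfl fun β _ ↦ (fderiv_dSuperpotential hg hdet μ ν α β).2

/-! ### Registered sub-goal form -/

/-- Registered sub-goal form (part 3) of `fderiv_superpotential` (the `1`-jet expansion of `∂_β H^{μβνα}`; the `2`-jet expansion `emComplex_eq_twoJet` exceeds the registry's size cap). [cite: LandauLifshitz1975, §96 (96.2)] -/
theorem pseudotensorBound_fderiv_superpotential : open Literature.Geometry.Lorentzian in ∀ {g : E4 → E4 →L[ℝ] E4 →L[ℝ] ℝ} {y : E4}, DifferentiableAt ℝ g y → LandauLifshitz.metricDet g y ≠ 0 → ∀ μ ν α β : Fin 4, fderiv ℝ (fun z ↦ LandauLifshitz.superpotential g z μ β ν α) y (E4.basisVector β) = (-(LandauLifshitz.metricDet g y * (∑ t1, ∑ t2, LandauLifshitz.upper g y t1 t2 * fderiv ℝ g y (E4.basisVector β) (E4.basisVector t2) (E4.basisVector t1)))) * (LandauLifshitz.upper g y μ ν * LandauLifshitz.upper g y β α - LandauLifshitz.upper g y β ν * LandauLifshitz.upper g y μ α) + LandauLifshitz.metricDet g y * ((∑ v1, ∑ v2, LandauLifshitz.upper g y μ v1 *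 LandauLifshitz.upper g y v2 ν * fderiv ℝ g y (E4.basisVector β) (E4.basisVector v1) (E4.basisVector v2)) * LandauLifshitz.upper g y β α + LandauLifshitz.upper g y μ ν * (∑ v1, ∑ v2, LandauLifshitz.upper g y β v1 * LandauLifshitz.upper g y v2 α * fderiv ℝ g y (E4.basisVector β) (E4.basisVector v1) (E4.basisVector v2)) - (∑ v1, ∑ v2, LandauLifshitz.upper g y β v1 * LandauLifshitz.upper g y v2 ν * fderiv ℝ g y (E4.basisVector β) (E4.basisVector v1) (E4.basisVector v2)) * LandauLifshitz.upper g y μ α - LandauLifshitz.upper g y β ν * (∑ v1, ∑ v2, LandauLifshitz.upper g y μ v1 * LandauLifshitz.upper g y v2 α * fderiv ℝ g y (E4.basisVector β) (E4.basisVector v1) (E4.basisVector v2))) :=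
  fun hgy hdet μ ν α β ↦ fderiv_superpotential hgy hdet μ ν α β

end Summit.FinalStateConjecture.FinalStateConjecture.Theorems.SublinearIsFree.PseudotensorBound

end
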